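import Summits.ResolutionOfSingularities.ResolutionOfSingularities.Theorems.MarkingBudgetKernels
import HarnessLib

/-!
# WeightDescentClasses — decomp-res node «WeightDescent» (lens-4 g16; CRITIC-LEDGER row 108 CLEARED:
DECIDED-MOD-PORT +2 cells, located residual (L,P,drift))
refining the MaxContactCut aside 32260 (host of the lens-4 column).  Tree file 1/3 of the node.

Content VERBATIM from the decomp-res lens-4 cumulative file `HOME/decomp-res-lens-4/g18/CouplingCut.lean` (sha256
5bf7b2ca8f7311e8;
its §1–§6 = g14 HugValuationCut, ALREADY in the tree as `Theorems/HugValuationCut{Chains,Classes,Kernels}` +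
`MaxContactCutHugValuationCut`; §7–§12 = g15 «MarkingBudget» @369c12ac; §13–§17 = g16 «WeightDescent»
@1cb1c32f; §18–§23 = g17
«FactorContact» @daf245ab; §24–§31 = g18 «CouplingCut»).  HOME = run/shared/lean/pub/decomp-res.

Route-independent, OUTSIDE the Theses cone (importable by the route file for asides): §13 the PRINCIPAL AXIS on a hug shadow
(`HugShadow.Principal`, `topOrder`, top/tail locus, `Pure`, `TopIsolated` / `TailIsolated` / `FactorIsolated` /
`Drifting`); §14 the CELLS of
the in-locus column (L): (L,¬P) `NonPrincipalInLocusTowersTerminate`, (L,P,pure) `PurePrincipalTowersTerminate`, (L,P,isolated)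
`FactorIsolatedTowersTerminate`, (L,P,drift) `DriftingTowersTerminate` = the LOCATED RESIDUAL of g16; §15 the
descent port `DescentPort`
(COSTUME, counted 0) + `descentPort_one_iff`; §17 the all-weights classes `DescentPortAll`, `NoNonPrincipalInLocusTowers`,
`NoPurePrincipalTowers`, `NoDriftingTowers`, `NoFactorIsolatedTowers` (aside statements).  Kernels:
`WeightDescentKernels`; BY-NAME wiring:
`MaxContactCutWeightDescent`.

[WRITER NOTE (decomp-res writer g6): the whole lens-4 chain lives in ONE namespace `…Theorems.HugValuationCut` (the tree's g14
namespace) so that the lens's `HugChain.`/`HugShadow.`/`MarkedShadow.` dot-notation extends the landed structures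
verbatim; the lens's
`noTower_iff_perfect_and_imperfect` is the tree's `ContactShadowKernels.noTower_iff_columns`; `set_option` lines
dropped; cone-free
(no `Theses` import) so the route file can import it for asides; the BY-NAME wiring to the MaxContactCut items is in the
`MaxContactCut<Node>` companion files.]
(Sources: CossartJannsenSaito2020 Key Thm. 6.40, Cor. 6.37, Lem. 6.35/6.36; BierstoneGrigorievMilmanWlodarczyk2011
§3 (marked ideals, Lem. 3.2.1, §3.7); CossartPiltant2019; Abhyankar1956; Cutkosky2009 §2.1.)
-/

noncomputable section

open CategoryTheory AlgebraicGeometry IsLocalRing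
open Literature.AlgebraicGeometry.Resolution
open Summit.ResolutionOfSingularities.ResolutionOfSingularities.Theorems
open WeakOrderReduction ForcedTowerClasses DivergentTowerClasses MonomialTowerClasses
open HugDimensionClasses HugDimensionKernels SurfaceShadowClasses SurfaceShadowKernels
open ContactShadowClasses (NoTowerImperfect)
open ContactShadowKernels (noTowerImperfect_of_noTower noTowerImperfect_mono noTower_iff_columns)
open NearPointCut (SingularClass singularSurface_iff_noTower)

namespace Summit.ResolutionOfSingularities.ResolutionOfSingularities.Theorems.HugValuationCut

variable {K : Type} [Field K]

/-! ## §13 (g16 · NEW) The PRINCIPAL AXIS: the hugged surface as a FACTOR of the marking, and the two factor orders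
(PROVED bookkeeping; the geometry is in the module docstring, (D1)–(D5)) -/

/-- The marking is CONSTANT along a forced tower (BGMW transforms keep `μ`: `MarkedIdeal.transform_mult`). [folklore] -/
theorem towerMult_eq (T : ForcedTower) : ∀ j : ℕ, (T.D j).mult = (T.D 0).mult
  | 0 => rfl
  | j + 1 => by rw [T.transform_eq j, MarkedIdeal.transform_mult]; exact towerMult_eq T j

/-- In a forced tower of weight `n` the marked point has order `≥ n` at EVERY stage (it lies in the support of the
transformed marked ideal, whose marking is still `n`). [folklore] -/
theorem weight_le_order (T : ForcedTower) {n : ℕ} (hD : IsDatum n (T.D 0)) (j : ℕ) :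
    (n : ℕ∞) ≤ idealOrder (T.D j).ideal (T.pt j) := by
  have h : ((T.D j).mult : ℕ∞) ≤ idealOrder (T.D j).ideal (T.pt j) := (T.isolated j).1
  rwa [towerMult_eq T j, hD.1] at h

/-- The order is ANTITONE in the ideal: `I_y ⊆ J_y ⇒ ord_y J ≤ ord_y I`. [folklore] -/
theorem idealOrder_anti {Y : Scheme.{0}} {I J : Y.IdealSheafData} {y : Y} (h : stalkIdeal I y ≤ stalkIdeal J y) :
    idealOrder J y ≤ idealOrder I y :=
  ENat.forall_natCast_le_iff_le.mp fun i hi =>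
    (le_idealOrder_iff I y i).mpr (h.trans ((le_idealOrder_iff J y i).mp hi))

namespace HugShadow

variable {T : ForcedTower} (S : HugShadow T)

/-- **PRINCIPAL hug**: the stalk `𝓘(Σ)_{pt m}` of the ideal of the hugged surface germ is a PRINCIPAL ideal of the
regular local ring `𝒪_{St m, pt m}` — the hugged surface is (locally) a HYPERSURFACE `Σ = V(g)`.  Automatic when
`dim 𝒪_{St m, pt m} = 3` (height-one prime of a UFD, tree `RegularLocalRingsUFD`); never when it is `4` (the germ has
codimension two).  The principal axis is thus the DIMENSION axis `d = 3 ∣ d = 4` read on the hug. -/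
def Principal : Prop :=
  (stalkIdeal S.germ (T.pt S.m)).IsPrincipal

/-- **THE TOP ORDER `ν_j := ord_{pt (m+j)} Σ_j`** — the multiplicity of the `j`-th strict transform of the hugged
surface at the marked point (finite and `≥ 1`: `one_le_topOrder`, `topOrder_zero_ne_top`; port-level: non-increasing
in `j`, `≥ 2` in the singular class, `≤ n` on in-locus shadows — (D1)). -/
def topOrder (j : ℕ) : ℕ∞ :=
  idealOrder (strictIter T S.m S.germ j) (T.pt (S.m + j))

/-- **THE TOP LOCUS `Top_j := {y | ord_y Σ_j ≥ ν_j}`** — the equimultiple locus of the hugged hypersurface through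
the marked point (its local Hilbert–Samuel = multiplicity stratum; the support of the FIRST FACTOR `(𝓘(Σ_j), ν_j)`). -/
def topLocus (j : ℕ) : Set (T.St (S.m + j)) :=
  {y | S.topOrder j ≤ idealOrder (strictIter T S.m S.germ j) y}

/-- **THE TAIL LOCUS `Tail_j := {y | ord_y I_j ≥ ord_y Σ_j + (n − ν_j)}`** — where the marking is principal-hugged,
`I_j = g_j · J_j` and orders add in the regular stalks, this is `{y | ord_y J_j ≥ n − ν_j}`: the support of the SECOND
FACTOR, the COFACTOR marked ideal `(J_j, n − ν_j)` ((D2), (D4)).  Typed intrinsically (no cofactor datum). -/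
def tailLocus (n j : ℕ) : Set (T.St (S.m + j)) :=
  {y | ((n : ℕ∞) - S.topOrder j) + idealOrder (strictIter T S.m S.germ j) y ≤ idealOrder (T.D (S.m + j)).ideal y}

/-- The marked point lies in its top locus. [folklore] -/
theorem mem_topLocus (j : ℕ) : T.pt (S.m + j) ∈ S.topLocus j :=
  show S.topOrder j ≤ S.topOrder j from le_rfl

/-- `ν_j ≥ 1`: the marked points lie on the strict transforms (the hug). [folklore] -/
theorem one_le_topOrder (j : ℕ) : 1 ≤ S.topOrder j :=
  (one_le_idealOrder_iff _ _).mpr (S.hugs.2 j)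

/-- `ν_0 < ∞`: the germ is non-zero at the hugging point. [folklore] -/
theorem topOrder_zero_ne_top : S.topOrder 0 ≠ ⊤ :=
  S.hugs.1

/-- On an IN-LOCUS shadow `ν_0 ≤ ord_{pt m} I_m` (`I_m ⊆ 𝓘(Σ)` at the hugging point; orders are antitone).
[folklore] -/
theorem topOrder_zero_le_order (h : S.InLocus) : S.topOrder 0 ≤ idealOrder (T.D S.m).ideal (T.pt S.m) :=
  idealOrder_anti h

/-- **PURE shadow of weight `n`**: eventually `ν_j = n` — the cofactor `J_j` is TRIVIAL at the marked point, the marking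
IS (locally, up to a unit) the hugged hypersurface with its multiplicity as the weight: `(I_j, n) = (𝓘(Σ_j), ν)`.  The
regime where weight descent has no teeth; g13's quasi-isolated column (CJS Key Theorem 6.40 / Cor. 6.37). -/
def Pure (n : ℕ) : Prop :=
  ∃ j₀ : ℕ, ∀ j, j₀ ≤ j → S.topOrder j = n

/-- **TOP-ISOLATED**: eventually the marked point is ISOLATED in the top locus of the hugged hypersurface — the first
factor `(𝓘(Σ_j), ν)` ALONE forces the tower from some stage on. -/
def TopIsolated : Prop :=
  ∃ j₀ : ℕ, ∀ j, j₀ ≤ j → IsIsolatedIn (S.topLocus j) (T.pt (S.m + j))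

/-- **TAIL-ISOLATED at weight `n`**: eventually the marked point is ISOLATED in the tail locus — the cofactor
`(J_j, n − ν)` ALONE forces the tower from some stage on. -/
def TailIsolated (n : ℕ) : Prop :=
  ∃ j₀ : ℕ, ∀ j, j₀ ≤ j → IsIsolatedIn (S.tailLocus n j) (T.pt (S.m + j))

/-- **FACTOR-ISOLATED**: one of the two factors eventually forces the tower by itself. -/
def FactorIsolated (n : ℕ) : Prop :=
  S.TopIsolated ∨ S.TailIsolated n

/-- **DRIFTING**: NEITHER factor ever forces the tower by itself — infinitely often an equimultiple curve of `Σ_j` AND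
infinitely often a curve of the cofactor's support pass through the marked point (which stays isolated in their
INTERSECTION `Top_j ∩ Tail_j ⊆ supp (I_j, n)`), while no single curve is hugged (`¬ CurveHugging`). -/
def Drifting (n : ℕ) : Prop :=
  ¬ S.TopIsolated ∧ ¬ S.TailIsolated n

/-- pure logic. [folklore] -/
theorem not_factorIsolated_iff (n : ℕ) : ¬ S.FactorIsolated n ↔ S.Drifting n :=
  not_or

/-- excluded middle on the isolation axis. [folklore] -/
theorem factorIsolated_or_drifting (n : ℕ) : S.FactorIsolated n ∨ S.Drifting n :=
  (Classical.em (S.FactorIsolated n)).imp_right (S.not_factorIsolated_iff n).mp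

end HugShadow

/-- Some hug shadow is principal (port-level: ⟺ the tower has dimension `3` at the hug). -/
def PrincipalShadow (T : ForcedTower) : Prop :=
  ∃ S : HugShadow T, S.Principal

/-- pure logic. [folklore] -/
theorem not_principalShadow_iff {T : ForcedTower} : ¬ PrincipalShadow T ↔ ∀ S : HugShadow T, ¬ S.Principal :=
  not_exists

/-! ## §14 (g16 · NEW) The cells of the in-locus column (L) cut by the principal axis × purity × factor isolation -/

/-- **CELL (L, ¬P) · UNDECIDED · IDEA-NEEDED (d = 4)**: in-locus singular-class towers NONE of whose shadows is
principal — the hugged singular surface has CODIMENSION TWO in a fourfold (no hypersurface factorisation). -/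
def NonPrincipalInLocusTowersTerminate (n : ℕ) : Prop :=
  NoTower n fun T => SingularClass T ∧ InLocusShadow T ∧ ∀ S : HugShadow T, ¬ S.Principal

/-- **CELL (L, P, pure) · DECIDED-MOD-PORT, INHERITED (no new credit)** — g13's quasi-isolated column
(`NearPointCut.quasiIsolated_of_keyTheorem640`, tree fact `KeyTheorem640_char` = CJS Thm. 6.40 in its `_char` form, whose
characteristic hypothesis `char = 0 ∨ d + 2 ≤ 2p` is AUTOMATIC for surfaces, `d ≤ 2`; for hypersurface hugs in dimension
three moreover PROVED in the tree: `NearChainTermination.false_of_nearChain_tau_two` (τ = 2) and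
`CompletedChainDescent.false_of_fullChain_tau_one'` (τ = 1)): in-locus singular-class towers with a PURE principal shadow
— the marking is the hugged hypersurface itself, `(I_j, n) = (𝓘(Σ_j), ν)` near the marked point, which is then isolated
in the top (= Hilbert–Samuel) locus at every late stage ((D1)(c)).  THE NORMAL FORM OF A MINIMAL-WEIGHT COUNTEREXAMPLE. -/
def PurePrincipalTowersTerminate (n : ℕ) : Prop :=
  NoTower n fun T => SingularClass T ∧ InLocusShadow T ∧ ∃ S : HugShadow T, S.Principal ∧ S.Pure n

/-- **CELL (L, P, factor-isolated) · DECIDED BY WEIGHT INDUCTION modulo the COSTUME port `DescentPort`**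
(`factorIsolated_of_descent`; discharged outright in the all-weights kernel `forcedTowersTerminate_of_g16`): in-locus
singular-class towers with an impure principal shadow one of whose two factors eventually forces the tower ALONE — the
factor is a forced tower of weight `ν < n` or `n − ν < n` over the same ground field. -/
def FactorIsolatedTowersTerminate (n : ℕ) : Prop :=
  NoTower n fun T => SingularClass T ∧ InLocusShadow T ∧ ∃ S : HugShadow T, S.Principal ∧ ¬ S.Pure n ∧ S.FactorIsolated n

/-- its top half (descends to the hugged hypersurface `(𝓘(Σ_j), ν)`, weight `ν < n`). -/
def TopIsolatedImpureTowersTerminate (n : ℕ) : Prop :=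
  NoTower n fun T => SingularClass T ∧ InLocusShadow T ∧ ∃ S : HugShadow T, S.Principal ∧ ¬ S.Pure n ∧ S.TopIsolated

/-- its tail half (descends to the cofactor `(J_j, n − ν)`, weight `n − ν < n`). -/
def TailIsolatedImpureTowersTerminate (n : ℕ) : Prop :=
  NoTower n fun T => SingularClass T ∧ InLocusShadow T ∧ ∃ S : HugShadow T, S.Principal ∧ ¬ S.Pure n ∧ S.TailIsolated n

/-- **CELL (L, P, drifting) = THE LOCATED RESIDUAL of the principal in-locus column · UNDECIDED · INSTRUMENTABLE
(I-Z″) · IDEA-NEEDED**: in-locus singular-class towers with an impure principal shadow along which NEITHER factor ever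
forces the tower alone (normal form in the module docstring, (N)). -/
def DriftingTowersTerminate (n : ℕ) : Prop :=
  NoTower n fun T => SingularClass T ∧ InLocusShadow T ∧ ∃ S : HugShadow T, S.Principal ∧ ¬ S.Pure n ∧ S.Drifting n

/-- the whole principal in-locus column (display). -/
def PrincipalInLocusTowersTerminate (n : ℕ) : Prop :=
  NoTower n fun T => SingularClass T ∧ InLocusShadow T ∧ PrincipalShadow T

/-! ## §15 (g16 · NEW) The descent port (COSTUME, counted 0; paper proof (D1)–(D5) in the module docstring) -/

/-- **PORT `DescentPort n` — COSTUME (BGMW functoriality of the two factors; paper proof (D1)–(D5))**: along an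
in-locus principal shadow of an infinite singular-class tower of weight `n` that is NOT pure and one of whose factors
eventually forces the tower alone, the TAIL OF THE TOWER from a late stage `m + j₀` on, restricted to an open
neighbourhood of the marked point and RE-MARKED by that factor — `(𝓘(Σ_j), ν)` of weight `ν`, or the cofactor
`(J_j, n − ν)` of weight `n − ν` — is again an infinite forced tower of the class over the SAME ground
field, of a weight
`n'` with `1 ≤ n' < n`.  The extremal move of this generation: A MINIMAL-WEIGHT COUNTEREXAMPLE IS PURE OR DRIFTING. -/
def DescentPort (n : ℕ) : Prop :=
  ∀ p : ℕ, p.Prime → ∀ (k : Type) [Field k] [CharP k p] (T : ForcedTower) (g : T.St 0 ⟶ Spec (.of k)),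
    IsBase (T.St 0) g → IsDatum n (T.D 0) → (T.D 0).boundary = [] → SingularClass T →
      ∀ S : HugShadow T, S.InLocus → S.Principal → ¬ S.Pure n → S.FactorIsolated n →
        ∃ n' : ℕ, 1 ≤ n' ∧ n' < n ∧ ∃ (T' : ForcedTower) (g' : T'.St 0 ⟶ Spec (.of k)),
          IsBase (T'.St 0) g' ∧ IsDatum n' (T'.D 0) ∧ (T'.D 0).boundary = []

/-- **THE PORT IS THE WEIGHT DROP (PROVED sanity anchor)**: at weight `1` the port says exactly that NO in-locus
principal shadow of a weight-one singular-class tower is impure-and-factor-isolated (there is no weight to descend to).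
[folklore] -/
theorem descentPort_one_iff :
    DescentPort 1 ↔ NoTower 1 fun T => SingularClass T ∧ ∃ S : HugShadow T,
      S.InLocus ∧ S.Principal ∧ ¬ S.Pure 1 ∧ S.FactorIsolated 1 := by
  constructor
  · intro h p hp k _ _ T g hB hD hE hT
    obtain ⟨hS, S, hin, hP, hnp, hF⟩ := hT
    obtain ⟨n', h1, h2, -⟩ := h p hp k T g hB hD hE hS S hin hP hnp hF
    omega
  · intro h p hp k _ _ T g hB hD hE hS S hin hP hnp hF
    exact (h p hp k T g hB hD hE ⟨hS, S, hin, hP, hnp, hF⟩).elim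

/-! ## §17 (g16 · NEW) Up to the booked MaxContactCut items BY NAME — the strong induction on the weight -/

/-- The descent port over all weights. -/
def DescentPortAll : Prop := ∀ n : ℕ, 1 ≤ n → DescentPort n

/-- The cell (L, ¬P) over all weights: «no singular-class in-locus tower hugs only codimension-two surfaces». -/
def NoNonPrincipalInLocusTowers : Prop := ∀ n : ℕ, 1 ≤ n → NonPrincipalInLocusTowersTerminate n

/-- The cell (L, P, pure) over all weights (g13's quasi-isolated column, inherited). -/
def NoPurePrincipalTowers : Prop := ∀ n : ℕ, 1 ≤ n → PurePrincipalTowersTerminate n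

/-- The located residual (L, P, drifting) over all weights. -/
def NoDriftingTowers : Prop := ∀ n : ℕ, 1 ≤ n → DriftingTowersTerminate n

/-- The cell ELIMINATED by the induction, over all weights (a CONSEQUENCE of the others: `noFactorIsolatedTowers_of_g16`). -/
def NoFactorIsolatedTowers : Prop := ∀ n : ℕ, 1 ≤ n → FactorIsolatedTowersTerminate n

end Summit.ResolutionOfSingularities.ResolutionOfSingularities.Theorems.HugValuationCut
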